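import Summits.Ventures.PercRepro.S1TrianglePlusCone

/-!
# PercRepro — LEMMA T⁺: the triangle count at bounded nullity, sharpened by `ν − 1` under (C1) alone
(p1, gen 20; a feeder lemma for SUBCLAIM-S1 §6.3 (a), «a structural `s₃` bound at small `ν`»)

In a finite matroid in which every rank-`2` set has at most `3` elements ((C1)), the number `s₃` of `3`-element
circuits satisfies `2·s₃ + ν ≤ ν² + 2`, i.e. `s₃ ≤ (ν² − ν + 2)/2`, where `ν = |E| − r(E)` is the nullity:
`1 · 2 · 4 · 7 · 11 · 16 · 22` at `ν = 1 … 7` against LEMMA T's `ν(ν + 1)/2 = 1 · 3 · 6 · 10 · 15 · 21 · 28`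
(`S1TriangleCount.two_mul_ncard_triangles_le`). Tight under (C1) alone at `ν ≤ 4` (`K₃`, two triangles on an
edge, `K₄`, the Fano plane).

PROOF. LEMMA T's deletion induction on `|E|` with ONE new case. Let `x` lie on a triangle and `t` be the number of
triangles through `x` (`t ≤ ν`, `ThmN.ncard_trianglesThrough_le`). If `t = ν`, THE CONE LEMMA
(`S1TrianglePlusCone.mem_of_mem_triangles_of_ncard_trianglesThrough_eq`) says every triangle contains `x`, so
`s₃ = t = ν ≤ (ν² − ν + 2)/2`. Otherwise `t ≤ ν − 1` and `s₃ ≤ t + s₃(M ＼ {x})`, where `M ＼ {x}` has nullity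
`ν − 1` and satisfies (C1), exactly as in LEMMA T: `2·s₃ + ν ≤ 2(ν − 1) + ((ν − 1)² − (ν − 1) + 2) + ν = ν² + 2`.

* **`two_mul_ncard_triangles_add_le`** — `2·#(triangles M) + d ≤ d·d + 2` when `|E| = r(E) + d` and (C1) holds;
* `ncard_triangles_le_of_nullity` — the same as `#(triangles M) ≤ (d·d + 2 − d) / 2`.
Axioms: standard.
-/

open scoped Matroid

namespace PercRepro

namespace S1

open Set

variable {α : Type}

/-- **LEMMA T⁺ — the triangle count at bounded nullity, sharpened.** If `|E| = r(E) + d` and every rank-`2` set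
has at most `3` elements, then `2·#(triangles M) + d ≤ d·d + 2`, i.e. `#(triangles M) ≤ (d² − d + 2)/2`. Deletion
induction on `|E|`: for a point `x` of some triangle, either every triangle contains `x` (the cone lemma; then
`#(triangles M) = #(triangles through x) = d`) or the triangles through `x` number at most `d − 1` and the others
are the triangles of `M ＼ {x}`, a matroid of nullity `d − 1` satisfying (C1). -/
theorem two_mul_ncard_triangles_add_le (M : Matroid α) [M.Finite]
    (hC1 : ∀ L ⊆ M.E, M.eRk L = 2 → L.ncard ≤ 3) {d : ℕ} (hd : M.E.encard = M.eRank + d) :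
    2 * (ThmN.triangles M).ncard + d ≤ d * d + 2 := by
  suffices H : ∀ n : ℕ, ∀ (M : Matroid α) [M.Finite], M.E.ncard = n →
      (∀ L ⊆ M.E, M.eRk L = 2 → L.ncard ≤ 3) → ∀ d : ℕ, M.E.encard = M.eRank + d →
      2 * (ThmN.triangles M).ncard + d ≤ d * d + 2 from H _ M rfl hC1 d hd
  intro n
  induction n using Nat.strong_induction_on with
  | _ n ih =>
  intro M _ hn hC1 d hd
  classical
  set S := ThmN.triangles M with hS
  have hSfin : S.Finite :=
    M.ground_finite.finite_subsets.subset (fun C hC => hC.1.subset_ground)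
  have hdd : d ≤ d * d + 2 := by nlinarith
  by_cases hSe : S = ∅
  · rw [hSe, ncard_empty]; omega
  obtain ⟨C₀, hC₀⟩ := nonempty_iff_ne_empty.2 hSe
  obtain ⟨e, heC₀⟩ := hC₀.1.nonempty
  have heE : e ∈ M.E := hC₀.1.subset_ground heC₀
  -- `e` is not a loop (it lies on a `3`-element circuit)
  have hx : M.IsNonloop e := by
    refine _root_.Matroid.isNonloop_of_not_isLoop heE ?_
    intro hloop
    have hC₀e : C₀ = {e} := hloop.eq_of_isCircuit_mem hC₀.1 heC₀
    have := hC₀.2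
    rw [hC₀e, ncard_singleton] at this
    omega
  -- split the triangles by whether they contain `e`
  set S₁ := ThmN.trianglesThrough M e with hS₁
  set S₂ := {C | M.IsCircuit C ∧ C.ncard = 3 ∧ e ∉ C} with hS₂
  have hsplit : S ⊆ S₁ ∪ S₂ := by
    intro C hC
    by_cases h : e ∈ C
    · exact Or.inl ⟨hC.1, hC.2, h⟩
    · exact Or.inr ⟨hC.1, hC.2, h⟩
  have hS₁fin : S₁.Finite := hSfin.subset (fun C hC => ⟨hC.1, hC.2.1⟩)
  have hS₂fin : S₂.Finite := hSfin.subset (fun C hC => ⟨hC.1, hC.2.1⟩)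
  have h1 : S₁.ncard ≤ d := ThmN.ncard_trianglesThrough_le M hC1 hx hd
  have h3 : S.ncard ≤ S₁.ncard + S₂.ncard := by
    calc S.ncard ≤ (S₁ ∪ S₂).ncard := ncard_le_ncard hsplit (hS₁fin.union hS₂fin)
      _ ≤ S₁.ncard + S₂.ncard := ncard_union_le _ _
  by_cases hcone : S₁.ncard = d
  · -- THE CONE CASE: every triangle contains `e`, so `#S = #S₁ = d`
    have hS₁S : S = S₁ := by
      apply Set.Subset.antisymm
      · intro C hC
        exact ⟨hC.1, hC.2,
          mem_of_mem_triangles_of_ncard_trianglesThrough_eq M hC1 hx hd hcone hC⟩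
      · intro C hC
        exact ⟨hC.1, hC.2.1⟩
    rw [hS₁S, hcone]
    have key : 3 * d ≤ d * d + 2 := by
      rcases Nat.lt_or_ge d 2 with h | h
      · interval_cases d <;> norm_num
      · obtain ⟨m, rfl⟩ : ∃ m, d = m + 2 := ⟨d - 2, by omega⟩
        nlinarith [Nat.zero_le (m * m)]
    omega
  -- OTHERWISE `#S₁ ≤ d − 1`: delete `e`
  have h1' : S₁.ncard + 1 ≤ d := by omega
  -- `e` lies on a circuit, so it is not a coloop: `M ＼ {e}` has nullity `d − 1`
  have hne : ¬ M.IsColoop e := hC₀.1.not_isColoop_of_mem heC₀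
  have hν : M✶.eRank = (d : ℕ∞) := by
    have h := _root_.Matroid.eRank_add_eRank_dual M
    rw [hd] at h
    exact WithTop.add_left_cancel (PercRepro.Matroid.eRank_ne_top_of_finite M) h
  have hdel := PercRepro.Matroid.dual_eRank_delete_singleton_add_one heE hne
  rw [hν] at hdel
  have hfin' : (M ＼ {e})✶.eRank ≠ ⊤ := by
    intro h
    rw [h] at hdel
    exact absurd hdel (by simp)
  obtain ⟨d', hd'⟩ := ENat.ne_top_iff_exists.1 hfin'
  have hdd' : d = d' + 1 := by
    rw [← hd'] at hdel
    exact_mod_cast hdel.symm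
  have hd'enc : (M ＼ {e}).E.encard = (M ＼ {e}).eRank + d' := by
    have h := _root_.Matroid.eRank_add_eRank_dual (M ＼ {e})
    rw [← hd'] at h
    exact h.symm
  have hdelE : (M ＼ {e}).E.ncard < n := by
    rw [_root_.Matroid.delete_ground, ← hn, ← ncard_sdiff_singleton_add_one heE M.ground_finite]
    omega
  -- (C1) passes to `M ＼ {e}`
  have hC1' : ∀ L ⊆ (M ＼ {e}).E, (M ＼ {e}).eRk L = 2 → L.ncard ≤ 3 := by
    intro L hL hr
    rw [_root_.Matroid.delete_ground] at hL
    rw [delete_singleton_eRk_eq hL] at hr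
    exact hC1 L (hL.trans sdiff_subset) hr
  -- the triangles avoiding `e` are the triangles of `M ＼ {e}`
  have h2 : 2 * S₂.ncard + d' ≤ d' * d' + 2 := by
    have hsub : S₂ ⊆ ThmN.triangles (M ＼ {e}) := by
      intro C hC
      exact ⟨_root_.Matroid.delete_isCircuit_iff.2 ⟨hC.1, disjoint_singleton_right.2 hC.2.2⟩, hC.2.1⟩
    have hle : S₂.ncard ≤ (ThmN.triangles (M ＼ {e})).ncard :=
      ncard_le_ncard hsub
        ((M ＼ {e}).ground_finite.finite_subsets.subset (fun C hC => hC.1.subset_ground))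
    have := ih _ hdelE (M ＼ {e}) rfl hC1' d' hd'enc
    omega
  subst hdd'
  nlinarith [h1', h2, h3]

/-- LEMMA T⁺ in the form `#(triangles M) ≤ (d·d + 2 − d) / 2` (`= 1 · 2 · 4 · 7 · 11 · 16 · 22` at `d = 1 … 7`). -/
theorem ncard_triangles_le_of_nullity (M : Matroid α) [M.Finite]
    (hC1 : ∀ L ⊆ M.E, M.eRk L = 2 → L.ncard ≤ 3) {d : ℕ} (hd : M.E.encard = M.eRank + d) :
    (ThmN.triangles M).ncard ≤ (d * d + 2 - d) / 2 := by
  have := two_mul_ncard_triangles_add_le M hC1 hd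
  omega

end S1

end PercRepro
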